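import Summits.QuantumFields.BalabanUV.Beta.GAN24.DirichletExhaustionCovariancePad
import Summits.QuantumFields.BalabanUV.Beta.GAN24.DirichletExhaustionQuadForm
import Summits.QuantumFields.BalabanUV.Beta.GAN24.DirichletExhaustionDeperiodise

/-!
# G-an2-4 ∕ (CONV-C), route R7, junction (S)(α) — PART A: PERIODISATION OF KERNELS ON THE BOND INDEX SET OF `ℤ^{d+1}` IS AN
# ALGEBRA HOMOMORPHISM ONTO THE MATRICES OF THE TORUS BOX (`per M (A ∘ B) = per M A * per M B`, `per M δ = 1`, transpose, padding)

G-an2-4 formalisation swarm `b2b-balaban-gan24-formalise-*`, leaf prover 06 (gen 40 = prover-b2b-balaban-gan24-formalise-leaf-06-g40-0),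
CRUX TEAM (2) under the coordinator ruling «YM REDIRECT TOWARDS THE SUMMIT» (e34b3e0c; FREEZE (0) honoured — bookkeeping over EXISTING
objects, no Support leaf, no cited fact; INTENT «STEP-COVARIANCE-PERIODISE», HOME/CLAIMS.log 2026-08-21 l.34155, statement-first with hold-off).
THE ITEM.  The pricing desk's CHECK #75 (a) (PRICING-GAN24 v3.16∕v3.17) and ref2 R235-1 name ONE remaining bookkeeping item for the R7
letter (L3)-Γ_u after this lineage's `StepCovarianceTwoClauses` (p291736): «(S) = the junction to the route's step-covariance object:
(α) the `deltaZ` ↔ `reDelK` periodisation junction of the two typings» — road P2's ℤ^{d+1} typing (`DirichletExhaustion*`: `deltaZ`, `elimZ`,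
`covPad … Λ`, END `convC_balaban`) versus pv09's torus typing (`B6Cov2156Torus.bondReductionT … (reDelK …)`, this lineage's `stepCov_*`).
THIS PART supplies the generic half: for kernels `F : K (d+1) N → K (d+1) N → ℝ` on the bond∕component index set of `ℤ^{d+1}` (pv23's
`B4Sect5Exhaustion.K`) and a period vector `M`, the PERIODISATION
  `per M F : Matrix (B4.Idx (pbox M) N) (B4.Idx (pbox M) N) ℝ`, `per M F p q = Σ'_{m ∈ ℤ^{d+1}} F p̃ (q̃ + M∘m)`
(`p̃ = amb p` the ambient index of a box index, pv17's `MultiPeriod.translate`), and proves (0 sorry, no cited fact):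
 * §1 the shift `sh M m (z, β) = (z + M∘m, β)`, its group law and the equivalence `shEquiv`; §2 the box × period-lattice ≃ bonds
   equivalence `unfoldEquiv` (`(r, m) ↦ r̃ + M∘m`, inverse by pv09's `wrap` and the quotient coordinates `quo`) and the UNFOLDING of
   absolutely convergent sums `tsum_eq_sum_tsum : Σ'_{s} H s = Σ_{r ∈ box} Σ'_m H (r̃ + M∘m)`; `amb_eq_sh_iff` (box points differ by a
   period only trivially);
 * §3 summability ∕ uniform bounds of periodised exponentially bounded kernels (`summable_sh`, `sum_abs_sh_le`, `tsum_abs_sh_le`: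
   `Σ'_m |B x (s̃ + M∘m)| ≤ b·N·K_{d+1}(β)` uniformly — pv23's `sum_expKernel_le`);
 * §4 the composition `comp A B p q = Σ'_r A p r·B r q` (its invariance, exponential bound and the identity `sandwich C Δ =
   comp (trK C) (comp Δ C)` are PART A2 `KernelPeriodisationInverse`);
 * §5 **`per_comp`**: for exponentially bounded `A, B` with `B` INVARIANT under the diagonal action of `Mℤ^{d+1}`,
   `per M (comp A B) = per M A * per M B` (the periodic function `Φ_q(s) = Σ'_m B s (q̃ + M∘m)`, `Summable.tsum_comm` on the dominated
   double family, the unfolding of §2); `per_delta` (`per M δ = 1`), `per_trK` (`per M Cᵀ = (per M C)ᵀ` for invariant `C`), `per_padOp`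
   (road P2's padding `padOp Free A` periodises to «`per M A` on free × free, `δ` elsewhere» for an invariant free set).
HONEST SCOPE.  [folklore] real analysis (absolutely convergent re-arrangements on `ℤ^{d+1} × Fin N`); the only new `def`s are the
bookkeeping maps `sh`, `shEquiv`, `quo`, `unfoldEquiv`, `per`, `comp` (no `Prop` is minted; hypotheses are explicit decay ∕ invariance
binders asserted of nothing).  Nothing printed enters as a hypothesis (ABSOLUTE RULE).  PARTS B∕C (`ElimPeriodise`, `StepCovariancePeriodise`)
apply this (with PART A2 `KernelPeriodisationInverse`: composition bounds, pv23's inverse kernel) to Bałaban's `C = elimZ L` ∕ `elimT L M` and to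
the step covariance.  It moves NO (CONV-C) clause; NOT (CONV-C) as typed, NEVER
«G-an2-4 closed», NOT NE2 ∕ NE3, NOT D1, NOT BetaPertH, NOT continuum, NOT Clay — not in print; our bookkeeping.  HONEST DEPENDENCY: continuum
YM on T⁴ ⇐ BetaPertH ∧ nine spine estimates (0/9 proved); BetaPertH ⇐ (D1) ∧ (D4) ∧ CAP+tail; G-an2-4 gates asym, D1 and NE2/3/4.
-/

noncomputable section

open scoped BigOperators
open Finset Real Filter Topology

namespace Summit.QuantumFields.BalabanUV.Beta.GAN24.KernelPeriodisation

open Literature.MathematicalPhysics.QuantumFieldTheory.Balaban1983to89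
open B4Sect5Proof (latticeConst latticeConst_nonneg)
open B4Sect5Exhaustion (K summable_expKernel tsum_expKernel_le sum_expKernel_le)
open B4TorusKernel.MultiPeriod (translate translate_injective)
open B4Reflection242 (translate_translate)
open B6Lemma24Torus (pbox mem_pbox wrap wrap_mem_pbox wrap_eq_self IsPeriod)
open B6Cov2156Torus (eq_of_mem_pbox_of_isPeriod one_le_M)
open Summit.QuantumFields.BalabanUV.Beta.GAN24.DirichletExhaustionSandwich (sandwich summable_sandwich)
open Summit.QuantumFields.BalabanUV.Beta.GAN24.DirichletExhaustionCovariance (trK)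
open Summit.QuantumFields.BalabanUV.Beta.GAN24.DirichletExhaustionCovariancePad (padOp)
open Summit.QuantumFields.BalabanUV.Beta.GAN24.DirichletExhaustionQuadForm (amb)
open Summit.QuantumFields.BalabanUV.Beta.GAN24.DirichletExhaustionDeperiodise (summable_translate translate_zero)

variable {d N : ℕ}

/-! ## §1 The shift by the period lattice -/

/-- the shift of a bond∕component index by the period lattice: `sh M m (z, β) = (z + M∘m, β)`. -/
def sh (M : Fin (d + 1) → ℕ) (m : Fin (d + 1) → ℤ) (s : K (d + 1) N) : K (d + 1) N := (translate M s.1 m, s.2)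

/-- first component of a shift. -/
@[simp] theorem sh_fst (M : Fin (d + 1) → ℕ) (m : Fin (d + 1) → ℤ) (s : K (d + 1) N) : (sh M m s).1 = translate M s.1 m := rfl

/-- second component of a shift. -/
@[simp] theorem sh_snd (M : Fin (d + 1) → ℕ) (m : Fin (d + 1) → ℤ) (s : K (d + 1) N) : (sh M m s).2 = s.2 := rfl

/-- `sh M 0 = id`. -/
@[simp] theorem sh_zero (M : Fin (d + 1) → ℕ) (s : K (d + 1) N) : sh M 0 s = s :=
  Prod.ext (translate_zero M s.1) rfl

/-- the group law `sh M m' ∘ sh M m = sh M (m + m')`. -/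
theorem sh_sh (M : Fin (d + 1) → ℕ) (m m' : Fin (d + 1) → ℤ) (s : K (d + 1) N) :
    sh M m' (sh M m s) = sh M (m + m') s :=
  Prod.ext (translate_translate M s.1 m m') rfl

/-- `sh M (−m)` undoes `sh M m`. -/
@[simp] theorem sh_neg_sh (M : Fin (d + 1) → ℕ) (m : Fin (d + 1) → ℤ) (s : K (d + 1) N) : sh M (-m) (sh M m s) = s := by
  rw [sh_sh, add_neg_cancel, sh_zero]

/-- `sh M m` undoes `sh M (−m)`. -/
@[simp] theorem sh_sh_neg (M : Fin (d + 1) → ℕ) (m : Fin (d + 1) → ℤ) (s : K (d + 1) N) : sh M m (sh M (-m) s) = s := by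
  rw [sh_sh, neg_add_cancel, sh_zero]

/-- the shift by `m` as an equivalence of the index set. -/
def shEquiv (M : Fin (d + 1) → ℕ) (m : Fin (d + 1) → ℤ) : K (d + 1) N ≃ K (d + 1) N where
  toFun := sh M m
  invFun := sh M (-m)
  left_inv s := sh_neg_sh M m s
  right_inv s := sh_sh_neg M m s

/-- `shEquiv` is `sh`. -/
@[simp] theorem shEquiv_apply (M : Fin (d + 1) → ℕ) (m : Fin (d + 1) → ℤ) (s : K (d + 1) N) : shEquiv M m s = sh M m s := rfl

/-- shifting a fixed index is injective in the lattice vector (all `M_i ≥ 1`). -/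
theorem sh_injective_left (M : Fin (d + 1) → ℕ) [∀ μ, NeZero (M μ)] (s : K (d + 1) N) :
    Function.Injective fun m : Fin (d + 1) → ℤ => sh M m s := fun _ _ h =>
  translate_injective (one_le_M M) s.1 (congrArg Prod.fst h)

/-- shifting by a fixed lattice vector is injective on the indices. -/
theorem sh_eq_sh_iff (M : Fin (d + 1) → ℕ) (m : Fin (d + 1) → ℤ) {p q : K (d + 1) N} : sh M m p = sh M m q ↔ p = q :=
  (shEquiv (N := N) M m).injective.eq_iff

/-! ## §2 The box × period lattice ≃ the bond index set -/

section Unfold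

variable (M : Fin (d + 1) → ℕ) [∀ μ, NeZero (M μ)]

/-- `M_i > 0`. -/
theorem M_pos (i : Fin (d + 1)) : 0 < M i := Nat.pos_of_ne_zero (NeZero.ne _)

/-- the quotient coordinates `quo M z = (z_i / M_i)_i` (floor division). -/
def quo (z : Fin (d + 1) → ℤ) : Fin (d + 1) → ℤ := fun i => z i / (M i : ℤ)

omit [∀ μ, NeZero (M μ)] in
/-- `z = wrap M z + M∘quo M z`. -/
theorem translate_wrap_quo (z : Fin (d + 1) → ℤ) : translate M (wrap M z) (quo M z) = z := by
  funext i
  simp only [B4TorusKernel.MultiPeriod.translate_apply, wrap, quo]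
  exact Int.emod_add_mul_ediv (z i) (M i)

omit [∀ μ, NeZero (M μ)] in
/-- a box point is the remainder of its translates. -/
theorem wrap_translate {x : Fin (d + 1) → ℤ} (hx : x ∈ pbox M) (m : Fin (d + 1) → ℤ) : wrap M (translate M x m) = x := by
  funext i
  obtain ⟨h0, h1⟩ := mem_pbox.1 hx i
  simp only [wrap, B4TorusKernel.MultiPeriod.translate_apply]
  rw [Int.add_mul_emod_self_left, Int.emod_eq_of_lt h0 h1]

/-- the quotient coordinates of a translate of a box point. -/
theorem quo_translate {x : Fin (d + 1) → ℤ} (hx : x ∈ pbox M) (m : Fin (d + 1) → ℤ) : quo M (translate M x m) = m := by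
  funext i
  obtain ⟨h0, h1⟩ := mem_pbox.1 hx i
  have hM : (M i : ℤ) ≠ 0 := by exact_mod_cast (M_pos M i).ne'
  simp only [quo, B4TorusKernel.MultiPeriod.translate_apply]
  rw [Int.add_mul_ediv_left _ _ hM, Int.ediv_eq_zero_of_lt h0 h1, zero_add]

/-- **box × period lattice ≃ bonds**: `(r, m) ↦ r̃ + M∘m`, inverse `s ↦ ((wrap s, β), quo s)`. -/
def unfoldEquiv : B4.Idx (pbox M) N × (Fin (d + 1) → ℤ) ≃ K (d + 1) N where
  toFun x := sh M x.2 (amb x.1)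
  invFun s := ((⟨wrap M s.1, wrap_mem_pbox (M_pos M) s.1⟩, s.2), quo M s.1)
  left_inv x := by
    obtain ⟨⟨⟨r, hr⟩, β⟩, m⟩ := x
    simp only [sh, amb, wrap_translate M hr, quo_translate M hr]
  right_inv s := by
    obtain ⟨z, β⟩ := s
    simp only [sh, amb, translate_wrap_quo]

/-- `unfoldEquiv (r, m) = sh M m r̃`. -/
@[simp] theorem unfoldEquiv_apply (x : B4.Idx (pbox M) N × (Fin (d + 1) → ℤ)) : unfoldEquiv M x = sh M x.2 (amb x.1) := rfl

/-- **UNFOLDING an absolutely convergent sum over the bonds of `ℤ^{d+1}` along the box and the period lattice**: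
`Σ'_{s} H s = Σ_{r ∈ box} Σ'_m H (r̃ + M∘m)`. [folklore] -/
theorem tsum_eq_sum_tsum {H : K (d + 1) N → ℝ} (hH : Summable H) :
    ∑' s, H s = ∑ r : B4.Idx (pbox M) N, ∑' m : Fin (d + 1) → ℤ, H (sh M m (amb r)) := by
  have hs : Summable fun x : B4.Idx (pbox M) N × (Fin (d + 1) → ℤ) => H (unfoldEquiv M x) :=
    (unfoldEquiv M).summable_iff.2 hH
  rw [← (unfoldEquiv M).tsum_eq H, hs.tsum_prod, tsum_fintype]
  rfl

/-- **box points differ by a period only trivially**: `p̃ = q̃ + M∘m ↔ m = 0 ∧ p = q`. -/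
theorem amb_eq_sh_iff {p q : B4.Idx (pbox M) N} {m : Fin (d + 1) → ℤ} : amb p = sh M m (amb q) ↔ m = 0 ∧ p = q := by
  constructor
  · intro h
    have h1 : (p.1 : Fin (d + 1) → ℤ) = translate M (q.1 : Fin (d + 1) → ℤ) m := congrArg Prod.fst h
    have h2 : p.2 = q.2 := by
      have h2' := congrArg Prod.snd h
      exact h2'
    have hper : IsPeriod M ((p.1 : Fin (d + 1) → ℤ) - (q.1 : Fin (d + 1) → ℤ)) := fun i =>
      ⟨m i, by rw [Pi.sub_apply, h1, B4TorusKernel.MultiPeriod.translate_apply]; ring⟩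
    have hpq : (p.1 : Fin (d + 1) → ℤ) = (q.1 : Fin (d + 1) → ℤ) := eq_of_mem_pbox_of_isPeriod p.1.2 q.1.2 hper
    refine ⟨?_, Prod.ext (Subtype.ext hpq) h2⟩
    funext i
    have hi := congrFun h1 i
    rw [B4TorusKernel.MultiPeriod.translate_apply, hpq] at hi
    have hM : (M i : ℤ) ≠ 0 := by exact_mod_cast (M_pos M i).ne'
    have : (M i : ℤ) * m i = 0 := by linarith
    exact (mul_eq_zero.1 this).resolve_left hM
  · rintro ⟨rfl, rfl⟩
    rw [sh_zero]

/-- the periodised Kronecker delta: `Σ'_m [p̃ = q̃ + M∘m] = [p = q]`. -/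
theorem tsum_ite_amb_eq_sh (p q : B4.Idx (pbox M) N) :
    ∑' m : Fin (d + 1) → ℤ, (if amb p = sh M m (amb q) then (1 : ℝ) else 0) = if p = q then 1 else 0 := by
  rw [tsum_eq_single 0]
  · simp only [amb_eq_sh_iff, true_and]
  · intro m hm
    rw [if_neg]
    rw [amb_eq_sh_iff]
    exact fun h => hm h.1

end Unfold

/-! ## §3 Periodising exponentially bounded kernels: summability and uniform bounds -/

section Bounds

variable (M : Fin (d + 1) → ℕ) [∀ μ, NeZero (M μ)]

/-- the periodised family `m ↦ B x (s̃ + M∘m)` of an exponentially bounded kernel is summable. -/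
theorem summable_sh {B : K (d + 1) N → K (d + 1) N → ℝ} {b β : ℝ} (hβ : 0 < β) (hb : 0 ≤ b)
    (hB : ∀ p q : K (d + 1) N, |B p q| ≤ b * Real.exp (-(β * dist p.1 q.1))) (x s : K (d + 1) N) :
    Summable fun m : Fin (d + 1) → ℤ => B x (sh M m s) :=
  summable_translate (f := fun z => B x (z, s.2)) (x₀ := x.1) hβ hb (fun z => hB x (z, s.2)) (one_le_M M) s.1

/-- finite partial sums of the periodised absolute values are bounded UNIFORMLY: `Σ_{m ∈ S} |B x (s̃ + M∘m)| ≤ b·N·K_{d+1}(β)`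
(the translates are distinct indices; pv23's `sum_expKernel_le`). -/
theorem sum_abs_sh_le {B : K (d + 1) N → K (d + 1) N → ℝ} {b β : ℝ} (hβ : 0 < β) (hb : 0 ≤ b)
    (hB : ∀ p q : K (d + 1) N, |B p q| ≤ b * Real.exp (-(β * dist p.1 q.1))) (x s : K (d + 1) N)
    (S : Finset (Fin (d + 1) → ℤ)) :
    ∑ m ∈ S, |B x (sh M m s)| ≤ b * (N * latticeConst (d + 1) β) := by
  classical
  calc ∑ m ∈ S, |B x (sh M m s)| ≤ ∑ m ∈ S, b * Real.exp (-(β * dist x.1 (sh M m s).1)) :=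
        Finset.sum_le_sum fun m _ => hB x (sh M m s)
    _ = b * ∑ m ∈ S, Real.exp (-(β * dist x.1 (sh M m s).1)) := by rw [Finset.mul_sum]
    _ = b * ∑ y ∈ S.image (fun m => sh M m s), Real.exp (-(β * dist x.1 y.1)) := by
        rw [Finset.sum_image fun m _ m' _ h => sh_injective_left M s h]
    _ ≤ b * (N * latticeConst (d + 1) β) := mul_le_mul_of_nonneg_left (sum_expKernel_le hβ x.1 _) hb

/-- … hence the full periodised sum of absolute values is `≤ b·N·K_{d+1}(β)`, uniformly in `x, s`. -/
theorem tsum_abs_sh_le {B : K (d + 1) N → K (d + 1) N → ℝ} {b β : ℝ} (hβ : 0 < β) (hb : 0 ≤ b)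
    (hB : ∀ p q : K (d + 1) N, |B p q| ≤ b * Real.exp (-(β * dist p.1 q.1))) (x s : K (d + 1) N) :
    ∑' m : Fin (d + 1) → ℤ, |B x (sh M m s)| ≤ b * (N * latticeConst (d + 1) β) :=
  (summable_sh M hβ hb hB x s).abs.tsum_le_of_sum_le (sum_abs_sh_le M hβ hb hB x s)

/-- … and so is the periodised sum itself in absolute value. -/
theorem abs_tsum_sh_le {B : K (d + 1) N → K (d + 1) N → ℝ} {b β : ℝ} (hβ : 0 < β) (hb : 0 ≤ b)
    (hB : ∀ p q : K (d + 1) N, |B p q| ≤ b * Real.exp (-(β * dist p.1 q.1))) (x s : K (d + 1) N) :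
    |∑' m : Fin (d + 1) → ℤ, B x (sh M m s)| ≤ b * (N * latticeConst (d + 1) β) := by
  have h := norm_tsum_le_tsum_norm (summable_sh M hβ hb hB x s).norm
  simp only [Real.norm_eq_abs] at h
  exact h.trans (tsum_abs_sh_le M hβ hb hB x s)

end Bounds

/-! ## §4 Composition of kernels -/

/-- the composition of two kernels on the bond index set: `comp A B p q = Σ'_r A p r·B r q`. -/
def comp (A B : K (d + 1) N → K (d + 1) N → ℝ) : K (d + 1) N → K (d + 1) N → ℝ := fun p q => ∑' r, A p r * B r q



/-! ## §5 Periodisation is an algebra homomorphism on invariant kernels -/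

/-- **the periodisation map**: `per M F p q = Σ'_m F p̃ (q̃ + M∘m)`, a matrix on the bond∕component indices of the torus box. -/
def per (M : Fin (d + 1) → ℕ) (F : K (d + 1) N → K (d + 1) N → ℝ) : Matrix (B4.Idx (pbox M) N) (B4.Idx (pbox M) N) ℝ :=
  fun p q => ∑' m : Fin (d + 1) → ℤ, F (amb p) (sh M m (amb q))

section Per

variable (M : Fin (d + 1) → ℕ)
variable {A B C : K (d + 1) N → K (d + 1) N → ℝ} {a b α β : ℝ}

/-- unfolding `per`. -/
theorem per_apply (F : K (d + 1) N → K (d + 1) N → ℝ) (p q : B4.Idx (pbox M) N) :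
    per M F p q = ∑' m : Fin (d + 1) → ℤ, F (amb p) (sh M m (amb q)) := rfl

/-- **`per M Cᵀ = (per M C)ᵀ`** for an `Mℤ^{d+1}`-invariant `C` (re-index `m ↦ −m`; no convergence needed). -/
theorem per_trK (hC : ∀ m p q, C (sh M m p) (sh M m q) = C p q) (p q : B4.Idx (pbox M) N) :
    per M (trK C) p q = per M C q p := by
  simp only [per_apply, trK]
  have h : ∀ m, C (sh M m (amb q)) (amb p) = C (amb q) (sh M (-m) (amb p)) := fun m => by
    rw [← hC (-m) (sh M m (amb q)) (amb p), sh_neg_sh]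
  simp_rw [h]
  exact (Equiv.neg (Fin (d + 1) → ℤ)).tsum_eq fun m => C (amb q) (sh M m (amb p))

/-- the periodic column functional `Φ_t(s) = Σ'_m B s (t + M∘m)` of an invariant `B` is `Mℤ^{d+1}`-periodic in `s`. -/
theorem tsum_sh_sh (hB : ∀ m p q, B (sh M m p) (sh M m q) = B p q) (m : Fin (d + 1) → ℤ) (s t : K (d + 1) N) :
    ∑' m' : Fin (d + 1) → ℤ, B (sh M m s) (sh M m' t) = ∑' m' : Fin (d + 1) → ℤ, B s (sh M m' t) := by
  have h : ∀ m', B (sh M m s) (sh M m' t) = B s (sh M (m' + -m) t) := fun m' => by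
    rw [← hB (-m) (sh M m s) (sh M m' t), sh_neg_sh, sh_sh]
  simp_rw [h]
  exact (Equiv.addRight (-m)).tsum_eq fun m' => B s (sh M m' t)

variable [∀ μ, NeZero (M μ)]

/-- **`per M δ = 1`**: the periodised Kronecker kernel is the identity matrix of the box. -/
theorem per_delta : per M (fun p q : K (d + 1) N => if p = q then (1 : ℝ) else 0) = 1 := by
  ext p q
  rw [per_apply, tsum_ite_amb_eq_sh, Matrix.one_apply]

/-- **periodising road P2's padding**: for an invariant free set, `per M (padOp Free A) p q` is `per M A p q` on free × free and the
Kronecker delta elsewhere. -/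
theorem per_padOp {Free : K (d + 1) N → Prop} [DecidablePred Free] (hFree : ∀ m s, Free (sh M m s) ↔ Free s)
    (p q : B4.Idx (pbox M) N) :
    per M (padOp Free A) p q = if Free (amb p) ∧ Free (amb q) then per M A p q else (if p = q then 1 else 0) := by
  simp only [per_apply, padOp, hFree]
  by_cases h : Free (amb p) ∧ Free (amb q)
  · simp only [h, and_self, if_true]
  · simp only [h, if_false]
    exact tsum_ite_amb_eq_sh M p q

/-- the dominated double family `(s, m) ↦ A x s · B s (t + M∘m)` is absolutely summable (exponential bounds on `A`, `B`). -/
theorem summable_uncurry_comp_sh (hα : 0 < α) (hβ : 0 < β) (ha : 0 ≤ a) (hb : 0 ≤ b)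
    (hA : ∀ p q : K (d + 1) N, |A p q| ≤ a * Real.exp (-(α * dist p.1 q.1)))
    (hB : ∀ p q : K (d + 1) N, |B p q| ≤ b * Real.exp (-(β * dist p.1 q.1))) (x t : K (d + 1) N) :
    Summable (Function.uncurry fun (s : K (d + 1) N) (m : Fin (d + 1) → ℤ) => A x s * B s (sh M m t)) := by
  have hg : Summable fun y : K (d + 1) N × (Fin (d + 1) → ℤ) => |A x y.1| * |B y.1 (sh M y.2 t)| := by
    refine (summable_prod_of_nonneg fun y => by positivity).2 ⟨fun s => ?_, ?_⟩
    · dsimp only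
      exact ((summable_sh M hβ hb hB s t).abs).mul_left _
    · dsimp only
      refine ((summable_expKernel hα x.1).mul_left (a * (b * (N * latticeConst (d + 1) β)))).of_nonneg_of_le
        (fun s => tsum_nonneg fun m => by positivity) fun s => ?_
      rw [tsum_mul_left]
      calc |A x s| * ∑' m : Fin (d + 1) → ℤ, |B s (sh M m t)|
          ≤ a * Real.exp (-(α * dist x.1 s.1)) * (b * (N * latticeConst (d + 1) β)) :=
            mul_le_mul (hA _ _) (tsum_abs_sh_le M hβ hb hB s t) (tsum_nonneg fun _ => abs_nonneg _) (by positivity)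
        _ = a * (b * (N * latticeConst (d + 1) β)) * Real.exp (-(α * dist x.1 s.1)) := by ring
  refine hg.of_norm_bounded fun y => ?_
  obtain ⟨s, m⟩ := y
  rw [Function.uncurry_apply_pair, Real.norm_eq_abs, abs_mul]

/-- **the periodised composition, unfolded on the left**: `Σ'_m (A ∘ B) x (t + M∘m) = Σ'_s A x s · Σ'_m B s (t + M∘m)` (Fubini). -/
theorem tsum_comp_sh (hα : 0 < α) (hβ : 0 < β) (ha : 0 ≤ a) (hb : 0 ≤ b)
    (hA : ∀ p q : K (d + 1) N, |A p q| ≤ a * Real.exp (-(α * dist p.1 q.1)))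
    (hB : ∀ p q : K (d + 1) N, |B p q| ≤ b * Real.exp (-(β * dist p.1 q.1))) (x t : K (d + 1) N) :
    ∑' m : Fin (d + 1) → ℤ, comp A B x (sh M m t) = ∑' s : K (d + 1) N, A x s * ∑' m : Fin (d + 1) → ℤ, B s (sh M m t) := by
  have hsw : ∑' (m : Fin (d + 1) → ℤ), ∑' (s : K (d + 1) N), A x s * B s (sh M m t)
      = ∑' (s : K (d + 1) N), ∑' (m : Fin (d + 1) → ℤ), A x s * B s (sh M m t) :=
    (summable_uncurry_comp_sh M hα hβ ha hb hA hB x t).tsum_comm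
  unfold comp
  rw [hsw]
  refine tsum_congr fun s => ?_
  exact tsum_mul_left

/-- the target family `s ↦ A x s · Φ_t(s)` is absolutely summable. -/
theorem summable_mul_tsum_sh (hα : 0 < α) (hβ : 0 < β) (ha : 0 ≤ a) (hb : 0 ≤ b)
    (hA : ∀ p q : K (d + 1) N, |A p q| ≤ a * Real.exp (-(α * dist p.1 q.1)))
    (hB : ∀ p q : K (d + 1) N, |B p q| ≤ b * Real.exp (-(β * dist p.1 q.1))) (x t : K (d + 1) N) :
    Summable fun s : K (d + 1) N => A x s * ∑' m : Fin (d + 1) → ℤ, B s (sh M m t) := by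
  refine ((summable_expKernel hα x.1).mul_left (a * (b * (N * latticeConst (d + 1) β)))).of_norm_bounded fun s => ?_
  rw [Real.norm_eq_abs, abs_mul]
  calc |A x s| * |∑' m : Fin (d + 1) → ℤ, B s (sh M m t)| ≤ a * Real.exp (-(α * dist x.1 s.1)) * (b * (N * latticeConst (d + 1) β)) :=
        mul_le_mul (hA _ _) (abs_tsum_sh_le M hβ hb hB s t) (abs_nonneg _) (by positivity)
    _ = a * (b * (N * latticeConst (d + 1) β)) * Real.exp (-(α * dist x.1 s.1)) := by ring

/-- **the matrix product of two periodisations, unfolded**: `(per M A * per M B) p q = Σ'_s A p̃ s · Σ'_m B s (q̃ + M∘m)` for invariant `B`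
(periodicity of the column functional + the unfolding of §2). -/
theorem per_mul_per_apply (hα : 0 < α) (hβ : 0 < β) (ha : 0 ≤ a) (hb : 0 ≤ b)
    (hA : ∀ p q : K (d + 1) N, |A p q| ≤ a * Real.exp (-(α * dist p.1 q.1)))
    (hB : ∀ p q : K (d + 1) N, |B p q| ≤ b * Real.exp (-(β * dist p.1 q.1)))
    (hBinv : ∀ m p q, B (sh M m p) (sh M m q) = B p q) (p q : B4.Idx (pbox M) N) :
    (per M A * per M B) p q = ∑' s : K (d + 1) N, A (amb p) s * ∑' m : Fin (d + 1) → ℤ, B s (sh M m (amb q)) := by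
  rw [Matrix.mul_apply, tsum_eq_sum_tsum M (summable_mul_tsum_sh M hα hβ ha hb hA hB (amb p) (amb q))]
  refine Finset.sum_congr rfl fun r _ => ?_
  rw [per_apply, per_apply, ← tsum_mul_right]
  refine tsum_congr fun m => ?_
  rw [tsum_sh_sh M hBinv]

/-- **`per_comp` — PERIODISATION IS MULTIPLICATIVE**: for exponentially bounded kernels `A, B` on the bond index set of `ℤ^{d+1}` with `B`
INVARIANT under the diagonal action of the period lattice, `per M (A ∘ B) = per M A * per M B`. [folklore] -/
theorem per_comp (hα : 0 < α) (hβ : 0 < β) (ha : 0 ≤ a) (hb : 0 ≤ b)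
    (hA : ∀ p q : K (d + 1) N, |A p q| ≤ a * Real.exp (-(α * dist p.1 q.1)))
    (hB : ∀ p q : K (d + 1) N, |B p q| ≤ b * Real.exp (-(β * dist p.1 q.1)))
    (hBinv : ∀ m p q, B (sh M m p) (sh M m q) = B p q) :
    per M (comp A B) = per M A * per M B := by
  ext p q
  rw [per_apply, tsum_comp_sh M hα hβ ha hb hA hB, per_mul_per_apply M hα hβ ha hb hA hB hBinv]

end Per

end Summit.QuantumFields.BalabanUV.Beta.GAN24.KernelPeriodisation

end
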